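import Mathlib
import Summits.KontsevichZagierPeriods.Zeta5Search.ThirdOrderNorms
import Summits.KontsevichZagierPeriods.Zeta5Search.ThirdOrderTypes
import Summits.KontsevichZagierPeriods.Zeta5Search.ThirdDigitVTransport
import Summits.KontsevichZagierPeriods.Zeta5Search.CollinearityDigits
import HarnessLib

/-!
# ζ(5) search — the DEEP PAIR IDENTITY to third order (P0 of gen-2 g10's THEOREM A⁗, REPORT-gen2-g10 §6.4)

Cell `pub-zeta5` (HONEST FRAMING: systematic search; no irrationality claim unless certified), typer seat generation 12.
For a non-self-conjugate class `x` of EVEN exponent `E ≤ −3` whose type list is a palindrome, and its conjugate class `x̄`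
(`Ω = W/(−p)^{E+3}`, `N = V/(−p)^E`, `L` the top level, `τ = (2ŵ₂ − Lŵ, 2v̂₂ − Lv̂) = (tauW, tauV)`):
**`(Ω, N)_x + (Ω, N)_x̄ ≡ −p ĝ_x (φ_x − pLc_x) · τ_x (mod p³)`** (`deep_pair₃`).
Ingredients: (W3)/(V3) for both classes (`deep3W_norm`, `deep3V_norm`), equality of the six functionals of `x` and `x̄`
(`functionals_conj_of_pal`), and the conjugation congruences `ĝ_x̄ ≡ −ĝ_x(1 − Lpφ_x + L²p²c_x) (mod p³)`,
`φ_x̄ ≡ −(φ_x + Lpφ₂,x) (mod p²)`, `c_x̄ ≡ c_x (mod p)`; the `p²`-terms cancel by `φ² − φ₂ = 2c` (`deepPair_identity`).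
`p`-adic valuations of rational numbers; nothing here concerns irrationality.
-/

noncomputable section

open Finset PowerSeries

namespace Summit.KontsevichZagierPeriods.Zeta5Search.SecondOrder

open Summit.KontsevichZagierPeriods.Zeta5Search.DualSeries (InBox)
open Summit.KontsevichZagierPeriods.Zeta5Search.WedgeDictionary (pfData)
open Summit.KontsevichZagierPeriods.Zeta5Search.CasoratianValuation (InPolytope)
open Summit.KontsevichZagierPeriods.Zeta5Search.ClusterValuation
open Summit.KontsevichZagierPeriods.Zeta5Search.PadicSeries
open Summit.KontsevichZagierPeriods.Zeta5Search.CellA (classW padicNorm_pow_eq padicNorm_p)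
open Summit.KontsevichZagierPeriods.Zeta5Search.LevelClass (level_mem)
open Summit.KontsevichZagierPeriods.Zeta5Search.BigPrime (padicNorm_mul_le_one)
open Summit.KontsevichZagierPeriods.Zeta5Search.CellKit (conj_level)

variable {p : ℕ} [hp : Fact p.Prime]

/-! ## §1 The algebra of the deep pair -/

omit hp in
/-- **The deep-pair identity.**  With `φ₂ = φ² − 2c`, `A = s₁ − pφs₂ + p²cs₃`, `A' = s₁ − pφ's₂ + p²c's₃`:
`−(1 − Lpφ + L²p²c)A' + A + p(φ − pLc)(2s₂ − Ls₁) = (1 − Lpφ + L²p²c)(p(φ' + φ + Lpφ₂)s₂ − p²(c' − c)s₃) + p³Q`. -/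
theorem deepPair_identity (pp L φ φ' φ₂ c c' s1 s2 s3 : ℚ) (hφ2 : φ₂ = φ ^ 2 - 2 * c) :
    -(1 - L * pp * φ + (L * pp) ^ 2 * c) * (s1 - pp * φ' * s2 + pp ^ 2 * c' * s3) + (s1 - pp * φ * s2 + pp ^ 2 * c * s3)
        + pp * (φ - pp * L * c) * (2 * s2 - L * s1) =
      (1 - L * pp * φ + (L * pp) ^ 2 * c) * (pp * (φ' + (φ + L * pp * φ₂)) * s2 - pp ^ 2 * (c' - c) * s3)
        + pp ^ 3 * (L ^ 2 * φ * φ₂ * s2 + L * φ * c * s3 - L ^ 2 * c * φ * s2 - L ^ 3 * pp * c * φ₂ * s2 - L ^ 2 * pp * c ^ 2 * s3) := by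
  rw [hφ2]; ring

/-- **The deep-pair bound** (generic): `‖gA + g'A' + pg(φ − pLc)(2s₂ − Ls₁)‖ ≤ p⁻³` from the three conjugation congruences. -/
theorem deepPair_bound {g g' φ φ' φ₂ c c' L s1 s2 s3 : ℚ} (hg : padicNorm p g ≤ 1) (hφ : padicNorm p φ ≤ 1)
    (hφ₂ : padicNorm p φ₂ ≤ 1) (hc : padicNorm p c ≤ 1) (hφ' : padicNorm p φ' ≤ 1) (hc' : padicNorm p c' ≤ 1)
    (hL : padicNorm p L ≤ 1) (hs1 : padicNorm p s1 ≤ 1) (hs2 : padicNorm p s2 ≤ 1) (hs3 : padicNorm p s3 ≤ 1)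
    (hε₃ : padicNorm p (g' + g * (1 - L * p * φ + (L * p) ^ 2 * c)) ≤ (p : ℚ) ^ (-(3 : ℤ)))
    (hε₂ : padicNorm p (φ' + (φ + L * p * φ₂)) ≤ (p : ℚ) ^ (-(2 : ℤ))) (hε₁ : padicNorm p (c' - c) ≤ (p : ℚ) ^ (-(1 : ℤ)))
    (hφ2 : φ₂ = φ ^ 2 - 2 * c) :
    padicNorm p (g * (s1 - (p : ℚ) * φ * s2 + (p : ℚ) ^ 2 * c * s3) + g' * (s1 - (p : ℚ) * φ' * s2 + (p : ℚ) ^ 2 * c' * s3)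
      + (p : ℚ) * g * (φ - (p : ℚ) * L * c) * (2 * s2 - L * s1)) ≤ (p : ℚ) ^ (-(3 : ℤ)) := by
  have hp0 : (p : ℚ) ≠ 0 := Nat.cast_ne_zero.2 hp.out.ne_zero
  have hp1 : padicNorm p (p : ℚ) ≤ 1 := padicNorm_p_le_one
  have hpn : padicNorm p (p : ℚ) = (p : ℚ) ^ (-(1 : ℤ)) := padicNorm_p
  set A' := s1 - (p : ℚ) * φ' * s2 + (p : ℚ) ^ 2 * c' * s3 with hA'
  set U := 1 - L * (p : ℚ) * φ + (L * (p : ℚ)) ^ 2 * c with hU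
  have e : g * (s1 - (p : ℚ) * φ * s2 + (p : ℚ) ^ 2 * c * s3) + g' * A' + (p : ℚ) * g * (φ - (p : ℚ) * L * c) * (2 * s2 - L * s1) =
      (g' + g * U) * A' + g * (-U * A' + (s1 - (p : ℚ) * φ * s2 + (p : ℚ) ^ 2 * c * s3)
        + (p : ℚ) * (φ - (p : ℚ) * L * c) * (2 * s2 - L * s1)) := by ring
  rw [e, hA', hU, deepPair_identity (p : ℚ) L φ φ' φ₂ c c' s1 s2 s3 hφ2]
  -- norms of the building blocks
  have hLp : padicNorm p (L * (p : ℚ)) ≤ 1 := padicNorm_mul_le_one hL hp1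
  have hUn : padicNorm p (1 - L * (p : ℚ) * φ + (L * (p : ℚ)) ^ 2 * c) ≤ 1 :=
    (padicNorm.nonarchimedean (p := p)).trans (max_le ((padicNorm.sub (p := p)).trans (max_le (by rw [padicNorm.one])
      (padicNorm_mul_le_one hLp hφ))) (padicNorm_mul_le_one (by rw [padicNorm_pow_eq]; exact pow_le_one₀ (padicNorm.nonneg _) hLp) hc))
  have hA'n : padicNorm p (s1 - (p : ℚ) * φ' * s2 + (p : ℚ) ^ 2 * c' * s3) ≤ 1 :=
    (padicNorm.nonarchimedean (p := p)).trans (max_le ((padicNorm.sub (p := p)).trans (max_le hs1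
      (padicNorm_mul_le_one (padicNorm_mul_le_one hp1 hφ') hs2)))
      (padicNorm_mul_le_one (padicNorm_mul_le_one (by rw [padicNorm_pow_eq]; exact pow_le_one₀ (padicNorm.nonneg _) hp1) hc') hs3))
  refine (padicNorm.nonarchimedean (p := p)).trans (max_le (padicNorm_mul_le_left hε₃ hA'n) ?_)
  refine padicNorm_mul_le_right hg ((padicNorm.nonarchimedean (p := p)).trans (max_le ?_ ?_))
  · refine padicNorm_mul_le_right hUn ((padicNorm.sub (p := p)).trans (max_le ?_ ?_))
    · rw [padicNorm.mul, padicNorm.mul, hpn]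
      calc (p : ℚ) ^ (-(1 : ℤ)) * padicNorm p (φ' + (φ + L * p * φ₂)) * padicNorm p s2
          ≤ (p : ℚ) ^ (-(1 : ℤ)) * (p : ℚ) ^ (-(2 : ℤ)) * 1 :=
            mul_le_mul (mul_le_mul_of_nonneg_left hε₂ (zpow_p_nonneg _)) hs2 (padicNorm.nonneg _)
              (mul_nonneg (zpow_p_nonneg _) (zpow_p_nonneg _))
        _ = (p : ℚ) ^ (-(3 : ℤ)) := by rw [mul_one, ← zpow_add₀ hp0]; norm_num
    · have e2 : (p : ℚ) ^ 2 * (c' - c) * s3 = (p : ℚ) ^ 2 * ((c' - c) * s3) := by ring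
      rw [e2]
      exact (padicNorm_p_pow_mul_le 2 (padicNorm_mul_le_left hε₁ hs3)).trans (le_of_eq (by rw [← zpow_add₀ hp0]; norm_num))
  · have hL2 : padicNorm p (L ^ 2) ≤ 1 := by rw [padicNorm_pow_eq]; exact pow_le_one₀ (padicNorm.nonneg _) hL
    have hL3 : padicNorm p (L ^ 3) ≤ 1 := by rw [padicNorm_pow_eq]; exact pow_le_one₀ (padicNorm.nonneg _) hL
    have hc2 : padicNorm p (c ^ 2) ≤ 1 := by rw [padicNorm_pow_eq]; exact pow_le_one₀ (padicNorm.nonneg _) hc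
    have hin : padicNorm p (L ^ 2 * φ * φ₂ * s2 + L * φ * c * s3 - L ^ 2 * c * φ * s2 - L ^ 3 * p * c * φ₂ * s2
        - L ^ 2 * p * c ^ 2 * s3) ≤ 1 := by
      refine (padicNorm.sub (p := p)).trans (max_le ((padicNorm.sub (p := p)).trans
        (max_le ((padicNorm.sub (p := p)).trans (max_le ((padicNorm.nonarchimedean (p := p)).trans (max_le ?_ ?_)) ?_)) ?_)) ?_)
      · exact padicNorm_mul_le_one (padicNorm_mul_le_one (padicNorm_mul_le_one hL2 hφ) hφ₂) hs2
      · exact padicNorm_mul_le_one (padicNorm_mul_le_one (padicNorm_mul_le_one hL hφ) hc) hs3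
      · exact padicNorm_mul_le_one (padicNorm_mul_le_one (padicNorm_mul_le_one hL2 hc) hφ) hs2
      · exact padicNorm_mul_le_one (padicNorm_mul_le_one (padicNorm_mul_le_one (padicNorm_mul_le_one hL3 hp1) hc) hφ₂) hs2
      · exact padicNorm_mul_le_one (padicNorm_mul_le_one (padicNorm_mul_le_one hL2 hp1) hc2) hs3
    exact (padicNorm_p_pow_mul_le 3 hin).trans (by rw [mul_one]; norm_num)

/-! ## §2 The deep pair identity (P0) -/

section Deep

variable (b : ℕ → ℤ) (hb : InPolytope b) (hp5 : 5 ≤ p) (hpn : (p : ℤ) ≤ b 0) (hwin : (b 0 + 2 : ℤ) < (p : ℤ) ^ 2)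
  {x : ℕ} (hx : x < p) (hpole : 1 ≤ classPoleCount b p x) (hc : ¬ CentreIn b p x)
  (hpal : (classTypeList b p x).reverse = classTypeList b p x) (heven : Even (classExp b p x)) (hE3 : classExp b p x ≤ -3)
include hb hp5 hpn hwin hx hpole hc hpal heven hE3

/-- **P0 — the DEEP PAIR to third order.**  `(Ω,N)_x + (Ω,N)_x̄ ≡ −pĝ_x(φ_x − pLc_x)·(τ_W, τ_V)_x (mod p³)`. -/
theorem deep_pair₃ :
    padicNorm p (classW b p x / (-(p : ℚ)) ^ (classExp b p x + 3)
        + classW b p (conjClass b p x) / (-(p : ℚ)) ^ (classExp b p x + 3)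
        + (p : ℚ) * gHat b p x * (phiHat b p x - (p : ℚ) * (topLevel b p x : ℚ) * curvHat b p x) * tauW b p x)
        ≤ (p : ℚ) ^ (-(3 : ℤ)) ∧
      padicNorm p (classV b p x / (-(p : ℚ)) ^ (classExp b p x)
        + classV b p (conjClass b p x) / (-(p : ℚ)) ^ (classExp b p x)
        + (p : ℚ) * gHat b p x * (phiHat b p x - (p : ℚ) * (topLevel b p x : ℚ) * curvHat b p x) * tauV b p x)
        ≤ (p : ℚ) ^ (-(3 : ℤ)) := by
  have h0 : 0 ≤ b 0 := hb.1.1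
  have hp2 : p ≠ 2 := by omega
  obtain ⟨-, -, -, hn⟩ := thmA_data b hb hwin
  have hxn := le_b0_of_lt b hpn hx
  obtain ⟨hL, hL'⟩ := level_bounds' (p := p) b hxn
  set L := topLevel b p x with hLdef
  set xc := conjClass b p x with hxc
  obtain ⟨hx', hM2, hM2'⟩ := conj_level b hx hL hL'
  have hEc : classExp b p xc = classExp b p x := classExp_conj b h0 hxn
  have hpolec : 1 ≤ classPoleCount b p xc := by rw [hxc, classPoleCount_conj b h0 hxn]; exact hpole
  obtain ⟨hw, hw2, hw3, hv, hv2, hv3, htop⟩ := functionals_conj_of_pal b hb hpn hx hc hpal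
  -- (W3)/(V3) for both classes
  have hWx := deep3W_norm b hb hp5 hwin hx hpole
  have hVx := deep3V_norm b hb hp5 hwin hx hpole hE3
  have hWc := deep3W_norm b hb hp5 hwin hx' hpolec
  have hVc := deep3V_norm b hb hp5 hwin hx' hpolec (by rw [hEc]; exact hE3)
  rw [hEc, hw, hw2, hw3] at hWc
  rw [hEc, hv, hv2, hv3] at hVc
  -- the conjugation congruences
  have hε₃ := gHat_conj_third b hb hp5 hx hL hL' hc heven
  have hε₂ := phiHat_conj_second b hb hp5 hx hL hL'
  have hε₁ := curvHat_conj b hb hp5 hx hL hL'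
  -- norms
  have hg1 : padicNorm p (gHat b p x) ≤ 1 := padicNorm_gHat_le_one' b hp5 x
  have hφ1 : padicNorm p (phiHat b p x) ≤ 1 := padicNorm_phiHat_le_one b hp2 x
  have hφ21 : padicNorm p (phi2Hat b p x) ≤ 1 := padicNorm_phi2Hat_le_one b hp2 x
  have hc1 : padicNorm p (curvHat b p x) ≤ 1 := padicNorm_curvHat_le_one b hp2 x
  have hφ1' : padicNorm p (phiHat b p xc) ≤ 1 := padicNorm_phiHat_le_one b hp2 xc
  have hc1' : padicNorm p (curvHat b p xc) ≤ 1 := padicNorm_curvHat_le_one b hp2 xc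
  have hL1 : padicNorm p (L : ℚ) ≤ 1 := by simpa using padicNorm.of_nat (p := p) L
  have hφ2c : phi2Hat b p x = phiHat b p x ^ 2 - 2 * curvHat b p x := by rw [curvHat]; ring
  constructor
  · have hB := deepPair_bound (p := p) hg1 hφ1 hφ21 hc1 hφ1' hc1' hL1 (LevelClass.padicNorm_wHat_le_one b h0 hn hp2 x)
      (padicNorm_wHat2_le_one b h0 hn hp2 x) (padicNorm_wHat3_le_one b h0 hn hp2 x) hε₃ hε₂ hε₁ hφ2c
    have e : classW b p x / (-(p : ℚ)) ^ (classExp b p x + 3) + classW b p xc / (-(p : ℚ)) ^ (classExp b p x + 3)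
        + (p : ℚ) * gHat b p x * (phiHat b p x - (p : ℚ) * (L : ℚ) * curvHat b p x) * tauW b p x =
        (classW b p x / (-(p : ℚ)) ^ (classExp b p x + 3)
          - gHat b p x * (wHat b p x - (p : ℚ) * phiHat b p x * wHat2 b p x + (p : ℚ) ^ 2 * curvHat b p x * wHat3 b p x))
        + (classW b p xc / (-(p : ℚ)) ^ (classExp b p x + 3)
          - gHat b p xc * (wHat b p x - (p : ℚ) * phiHat b p xc * wHat2 b p x + (p : ℚ) ^ 2 * curvHat b p xc * wHat3 b p x))
        + (gHat b p x * (wHat b p x - (p : ℚ) * phiHat b p x * wHat2 b p x + (p : ℚ) ^ 2 * curvHat b p x * wHat3 b p x)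
          + gHat b p xc * (wHat b p x - (p : ℚ) * phiHat b p xc * wHat2 b p x + (p : ℚ) ^ 2 * curvHat b p xc * wHat3 b p x)
          + (p : ℚ) * gHat b p x * (phiHat b p x - (p : ℚ) * (L : ℚ) * curvHat b p x) * (2 * wHat2 b p x - (L : ℚ) * wHat b p x)) := by
      rw [tauW, ← hLdef]; ring
    rw [e]
    exact (padicNorm.nonarchimedean (p := p)).trans (max_le ((padicNorm.nonarchimedean (p := p)).trans (max_le hWx hWc)) hB)
  · have hB := deepPair_bound (p := p) hg1 hφ1 hφ21 hc1 hφ1' hc1' hL1 (LevelClass.padicNorm_vHat_le_one b h0 hn hp2 : padicNorm p (vHat b p x) ≤ 1)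
      (padicNorm_vHat2_le_one b h0 hn hp2 x) (padicNorm_vHat3_le_one b h0 hn hp2 x) hε₃ hε₂ hε₁ hφ2c
    have e : classV b p x / (-(p : ℚ)) ^ (classExp b p x) + classV b p xc / (-(p : ℚ)) ^ (classExp b p x)
        + (p : ℚ) * gHat b p x * (phiHat b p x - (p : ℚ) * (L : ℚ) * curvHat b p x) * tauV b p x =
        (classV b p x / (-(p : ℚ)) ^ (classExp b p x)
          - gHat b p x * (vHat b p x - (p : ℚ) * phiHat b p x * vHat2 b p x + (p : ℚ) ^ 2 * curvHat b p x * vHat3 b p x))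
        + (classV b p xc / (-(p : ℚ)) ^ (classExp b p x)
          - gHat b p xc * (vHat b p x - (p : ℚ) * phiHat b p xc * vHat2 b p x + (p : ℚ) ^ 2 * curvHat b p xc * vHat3 b p x))
        + (gHat b p x * (vHat b p x - (p : ℚ) * phiHat b p x * vHat2 b p x + (p : ℚ) ^ 2 * curvHat b p x * vHat3 b p x)
          + gHat b p xc * (vHat b p x - (p : ℚ) * phiHat b p xc * vHat2 b p x + (p : ℚ) ^ 2 * curvHat b p xc * vHat3 b p x)
          + (p : ℚ) * gHat b p x * (phiHat b p x - (p : ℚ) * (L : ℚ) * curvHat b p x) * (2 * vHat2 b p x - (L : ℚ) * vHat b p x)) := by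
      rw [tauV, ← hLdef]; ring
    rw [e]
    exact (padicNorm.nonarchimedean (p := p)).trans (max_le ((padicNorm.nonarchimedean (p := p)).trans (max_le hVx hVc)) hB)

end Deep

end Summit.KontsevichZagierPeriods.Zeta5Search.SecondOrder

end
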